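import Summits.CriticalPhenomena.CardyFormulaZ2.Theorems.CardyFlipRussoSquareFromVoronoiHubDilutionDefs
import Summits.CriticalPhenomena.CardyFormulaZ2.Theorems.CardyFlipRussoSquareFromVoronoiHubFaithfulPart1
import Literature.Probability.Percolation.SitePaths
import HarnessLib

/-!
# Stub `stub_latticeChain` of line `poisson-dilution-leg`, crux `SquareFromVoronoiHub`

The square-chain lemma of the lattice end of the Poisson-dilution leg of the crux
`Summit.CriticalPhenomena.CardyFormulaZ2.Theses.CardyFlipRusso.SquareFromVoronoiHub`
(stmt-CriticalPhenomena-6434, route `CardyFlipRusso`; lead c5 skeleton, definitions module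
`…SquareFromVoronoiHubDilutionDefs`): the analogue for unit cells with hub points of c4's block
chain lemma `…ChessboardChain`.

**Content.**  `latBlack θ` (lattice units) is the union of the closed unit squares `Sq(v)` about
the black sites `v ∈ θ.1`, minus the face centres `zGs (Sum.inr f)` whose hub coin `hubCoin f` is
white; `gsConfig θ` opens the lattice vertex `Sum.inl v` iff `v ∈ θ.1` and the centre vertex
`Sum.inr f` iff `hubCoin f ∈ θ.2`.  `stub_latticeChain`: at mesh `δ`, a sub-path `γ|[a,b]` with
`γ/δ ⊆ latBlack θ` is shadowed by a `Gs`-path of open vertices within `3δ/4` of it, from a vertex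
within `3δ/4` of `γ(a)` to one within `3δ/4` of `γ(b)`.

**Proof** (deterministic plane topology; Bollobás–Riordan, *Percolation* (2006), Ch. 7, proof of
Thm. 2, "a connected black set contains a lattice path", adapted to cells with hub points).
Rescale to mesh `1` (`exists_pathIn_of_continuousOn`).  Sample the piece at a modulus of uniform
continuity for `1/40` (`IsCompact.uniformContinuousOn_of_continuous`); each sample lies in a black
square, consecutive squares `Sq(v)`, `Sq(v')` have `|vᵢ - v'ᵢ| ≤ 1` (`pathIn_step`): equal, an
`ℤ²` edge, or diagonal.  In the diagonal case (`pathIn_of_diag`) the chain goes through a third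
black square at the common corner or through the corner's centre vertex when its coin is black;
one of the two happens (`exists_open_at_corner`): otherwise the piece between the two samples
stays within `1/20` of the corner, hence inside `(Sq(v) ∪ Sq(v')) ∖ {corner}`, where the signed
coordinate sum towards `v'` is `< 0` on `Sq(v)` and `> 0` on `Sq(v')` — it would vanish somewhere
(intermediate value theorem), i.e. the piece would pass through the removed corner.
-/

noncomputable section
open scoped Topology
open MeasureTheory Metric Set Filter
open Literature.Analysis.FunctionSpaces (PointConfig IsPoissonPointProcess existsUnique_isPoissonPointProcess_holds)
open Literature.Probability.Percolation (SiteConfig sitePercolation half blackRegion voronoiCrossing)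
open Literature.Probability.RandomPlanarGeometry (ConformalRectangle cardyFunction crossRatio)
open Summit.CriticalPhenomena.CardyFormulaZ2.Cruxes.SquareFromVoronoiHub.VoronoiBlocks (zGs Gs crudeCrossing siteCrossingProb voronoiCrossingProb squareFromVoronoiHub_iff)
namespace Summit.CriticalPhenomena.CardyFormulaZ2.Cruxes.SquareFromVoronoiHub.PoissonDilutionLeg

open Literature.Probability.Percolation (PathIn)
open Summit.CriticalPhenomena.CardyFormulaZ2.Cruxes.SquareFromVoronoiHub.VoronoiBlocks.Faithful

/-! ### Real-arithmetic bookkeeping -/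

/-- Coordinates are `1`-Lipschitz: a distance bound bounds both coordinate differences.
[folklore] -/
theorem abs_sub_le_of_dist_le {z w : ℂ} {r : ℝ} (h : dist z w ≤ r) :
    |z.re - w.re| ≤ r ∧ |z.im - w.im| ≤ r := by
  rw [Complex.dist_eq] at h
  have h1 : |z.re - w.re| ≤ ‖z - w‖ := by simpa using Complex.abs_re_le_norm (z - w)
  have h2 : |z.im - w.im| ≤ ‖z - w‖ := by simpa using Complex.abs_im_le_norm (z - w)
  exact ⟨h1.trans h, h2.trans h⟩

/-- A point within `21/40` of a site of `G_s` in both coordinates is within `3/4` of it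
(`2 · (21/40)² = 882/1600 < 900/1600 = (3/4)²`). [folklore] -/
theorem dist_zGs_le {z : ℂ} {u : (ℤ × ℤ) ⊕ (ℤ × ℤ)} (h1 : |z.re - (zGs u).re| ≤ 21 / 40)
    (h2 : |z.im - (zGs u).im| ≤ 21 / 40) : dist z (zGs u) ≤ 3 / 4 := by
  rw [← pow_le_pow_iff_left₀ dist_nonneg (by norm_num) two_ne_zero, Complex.dist_eq,
    Complex.sq_norm, Complex.normSq_apply, Complex.sub_re, Complex.sub_im]
  obtain ⟨h1a, h1b⟩ := abs_le.1 h1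
  obtain ⟨h2a, h2b⟩ := abs_le.1 h2
  nlinarith

/-- Two integers each within `1/2` of reals at distance `≤ 1/40` differ by at most `1`.
[folklore] -/
theorem int_sub_mem_of_abs_le {x x' : ℝ} {w w' : ℤ} (h : |x - w| ≤ 1 / 2)
    (h' : |x' - w'| ≤ 1 / 2) (hxx' : |x - x'| ≤ 1 / 40) :
    w' - w = 0 ∨ (w' - w = 1 ∨ w' - w = -1) := by
  obtain ⟨ha, hb⟩ := abs_le.1 h
  obtain ⟨ha', hb'⟩ := abs_le.1 h'
  obtain ⟨hc, hd⟩ := abs_le.1 hxx'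
  have h1 : w' < w + 2 := by exact_mod_cast (show (w' : ℝ) < w + 2 by linarith)
  have h2 : w - 2 < w' := by exact_mod_cast (show (w : ℝ) - 2 < w' by linarith)
  omega

/-- On the closed square about `w`, the signed coordinate towards the neighbour `w' = w ± 1`,
measured from the midpoint `m` of `w` and `w'`, is `≤ 0` and vanishes only at `m`. [folklore] -/
theorem mul_sub_nonpos {x m : ℝ} {w w' : ℤ} (hd : w' - w = 1 ∨ w' - w = -1)
    (hm : 2 * m = w + w') (hx : |x - w| ≤ 1 / 2) :
    ((w' : ℝ) - w) * (x - m) ≤ 0 ∧ (((w' : ℝ) - w) * (x - m) = 0 → x = m) := by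
  obtain ⟨ha, hb⟩ := abs_le.1 hx
  rcases hd with hd | hd
  · have hd' : ((w' : ℤ) : ℝ) = w + 1 := by exact_mod_cast (by omega : w' = w + 1)
    rw [hd', show ((w : ℝ) + 1 - w) * (x - m) = x - m by ring]
    exact ⟨by linarith, fun h => by linarith⟩
  · have hd' : ((w' : ℤ) : ℝ) = w - 1 := by exact_mod_cast (by omega : w' = w - 1)
    rw [hd', show ((w : ℝ) - 1 - w) * (x - m) = -(x - m) by ring]
    exact ⟨by linarith, fun h => by linarith⟩

/-- On the closed square about the neighbour `w'`, the same signed coordinate is `≥ 0` and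
vanishes only at the midpoint. [folklore] -/
theorem mul_sub_nonneg {x m : ℝ} {w w' : ℤ} (hd : w' - w = 1 ∨ w' - w = -1)
    (hm : 2 * m = w + w') (hx : |x - w'| ≤ 1 / 2) :
    0 ≤ ((w' : ℝ) - w) * (x - m) ∧ (((w' : ℝ) - w) * (x - m) = 0 → x = m) := by
  have hd' : w - w' = 1 ∨ w - w' = -1 := by omega
  have hm' : 2 * m = w' + w := by rw [hm, add_comm]
  obtain ⟨h1, h2⟩ := mul_sub_nonpos hd' hm' hx
  have e : ((w : ℝ) - w') * (x - m) = -(((w' : ℝ) - w) * (x - m)) := by ring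
  rw [e] at h1 h2
  exact ⟨by linarith, fun h => h2 (by linarith)⟩

/-- A closed unit square about the integer `w` (one coordinate) containing a point within `1/2`
(open) of the midpoint of `v` and `v' = v ± 1` has `w ∈ {v, v'}`. [folklore] -/
theorem eq_or_eq_of_abs_lt {x m : ℝ} {w v v' : ℤ} (hd : v' - v = 1 ∨ v' - v = -1)
    (hm : 2 * m = v + v') (hx : |x - w| ≤ 1 / 2) (hx' : |x - m| < 1 / 2) : w = v ∨ w = v' := by
  obtain ⟨ha, hb⟩ := abs_le.1 hx
  obtain ⟨hc, hc'⟩ := abs_lt.1 hx'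
  have h1 : 2 * w < v + v' + 2 := by exact_mod_cast (show (2 * w : ℝ) < v + v' + 2 by linarith)
  have h2 : v + v' - 2 < 2 * w := by exact_mod_cast (show (v : ℝ) + v' - 2 < 2 * w by linarith)
  omega

/-- A real within `1/2` of `v` and within `21/40` of `v' = v ± 1` is within `1/40` of their
midpoint. [folklore] -/
theorem abs_sub_mid_le {x m : ℝ} {v v' : ℤ} (hd : v' - v = 1 ∨ v' - v = -1)
    (hm : 2 * m = v + v') (h1 : |x - v| ≤ 1 / 2) (h2 : |x - v'| ≤ 21 / 40) :
    |x - m| ≤ 1 / 40 := by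
  obtain ⟨ha, hb⟩ := abs_le.1 h1
  obtain ⟨hc, hc'⟩ := abs_le.1 h2
  rw [abs_le]
  rcases hd with hd | hd
  · have hv' : ((v' : ℤ) : ℝ) = v + 1 := by exact_mod_cast (by omega : v' = v + 1)
    constructor <;> linarith
  · have hv' : ((v' : ℤ) : ℝ) = v - 1 := by exact_mod_cast (by omega : v' = v - 1)
    constructor <;> linarith

/-- `ℤ²` edges of `G_s` from coordinate differences. [folklore] -/
theorem inl_adj_inl_of {x y : ℤ × ℤ} (h : (x.1 - y.1 = 0 ∧ (x.2 - y.2 = 1 ∨ x.2 - y.2 = -1)) ∨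
    ((x.1 - y.1 = 1 ∨ x.1 - y.1 = -1) ∧ x.2 - y.2 = 0)) : Gs.Adj (Sum.inl x) (Sum.inl y) := by
  rw [Gs_adj_inl_inl_iff]
  rcases h with ⟨h1, h2 | h2⟩ | ⟨h1 | h1, h2⟩ <;> rw [h1, h2] <;> norm_num

/-! ### The corner argument -/

/-- **No crossing at a closed corner.**  Let a continuous piece `p|[s,s']` of the black region
`latBlack θ` stay within `1/40` of itself, start in the closed square about `v` and end in the
closed square about a DIAGONAL neighbour `v'` (`v' - v ∈ {±1}²`), and let `f` be the face whose
centre is their common corner.  Then one of the two other squares at that corner is black, or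
the corner's hub coin is black: otherwise every point of the piece lies in one of the two closed
squares minus the corner, where the signed coordinate sum towards `v'` is `< 0`, resp. `> 0`, so
by the intermediate value theorem it would vanish on the piece — at the removed corner itself.
[folklore] -/
theorem exists_open_at_corner (θ : LatConfig) {p : ℝ → ℂ} {s s' : ℝ} (hss' : s ≤ s')
    (hp : ContinuousOn p (Icc s s')) (hblack : ∀ t ∈ Icc s s', p t ∈ latBlack θ)
    (hnear : ∀ t ∈ Icc s s', ∀ t' ∈ Icc s s', dist (p t) (p t') ≤ 1 / 40) {v v' f : ℤ × ℤ}
    (hpv : |(p s).re - v.1| ≤ 1 / 2 ∧ |(p s).im - v.2| ≤ 1 / 2)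
    (hpv' : |(p s').re - v'.1| ≤ 1 / 2 ∧ |(p s').im - v'.2| ≤ 1 / 2)
    (hd₁ : v'.1 - v.1 = 1 ∨ v'.1 - v.1 = -1) (hd₂ : v'.2 - v.2 = 1 ∨ v'.2 - v.2 = -1)
    (hm₁ : 2 * ((f.1 : ℝ) + 1 / 2) = v.1 + v'.1) (hm₂ : 2 * ((f.2 : ℝ) + 1 / 2) = v.2 + v'.2) :
    (∃ w ∈ θ.1, (w.1 = v.1 ∧ w.2 = v'.2) ∨ (w.1 = v'.1 ∧ w.2 = v.2)) ∨ hubCoin f ∈ θ.2 := by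
  by_cases h5 : hubCoin f ∈ θ.2
  · exact Or.inr h5
  by_cases h34 : ∃ w ∈ θ.1, (w.1 = v.1 ∧ w.2 = v'.2) ∨ (w.1 = v'.1 ∧ w.2 = v.2)
  · exact Or.inl h34
  exfalso
  have hs : s ∈ Icc s s' := ⟨le_rfl, hss'⟩
  have hs' : s' ∈ Icc s s' := ⟨hss', le_rfl⟩
  -- the corner `zGs (Sum.inr f)` is removed: no point of the piece is the corner
  have hoff : ∀ t ∈ Icc s s', ¬((p t).re = f.1 + 1 / 2 ∧ (p t).im = f.2 + 1 / 2) := by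
    rintro t ht ⟨h1, h2⟩
    exact (hblack t ht).2 ⟨f, h5, Complex.ext (by rw [zGs_re_inr, h1]) (by rw [zGs_im_inr, h2])⟩
  -- `p s` is within `1/40` of the corner in each coordinate
  obtain ⟨hr, hi⟩ := abs_sub_le_of_dist_le (hnear s hs s' hs')
  have hsr : |(p s).re - (f.1 + 1 / 2)| ≤ 1 / 40 :=
    abs_sub_mid_le hd₁ hm₁ hpv.1 ((abs_sub_le _ (p s').re _).trans (by linarith [hpv'.1]))
  have hsi : |(p s).im - (f.2 + 1 / 2)| ≤ 1 / 40 :=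
    abs_sub_mid_le hd₂ hm₂ hpv.2 ((abs_sub_le _ (p s').im _).trans (by linarith [hpv'.2]))
  -- the signed coordinate sum towards `v'`
  obtain ⟨g, hg⟩ : ∃ g : ℝ → ℝ, ∀ t, g t = ((v'.1 : ℝ) - v.1) * ((p t).re - (f.1 + 1 / 2)) +
      ((v'.2 : ℝ) - v.2) * ((p t).im - (f.2 + 1 / 2)) := ⟨_, fun _ => rfl⟩
  have hgc : ContinuousOn g (Icc s s') := by
    have hre : ContinuousOn (fun t => (p t).re) (Icc s s') := Complex.continuous_re.comp_continuousOn hp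
    have him : ContinuousOn (fun t => (p t).im) (Icc s s') := Complex.continuous_im.comp_continuousOn hp
    rw [show g = _ from funext hg]
    exact (continuousOn_const.mul (hre.sub continuousOn_const)).add
      (continuousOn_const.mul (him.sub continuousOn_const))
  -- `g` does not vanish on the piece
  have key : ∀ t ∈ Icc s s', g t ≠ 0 := by
    intro t ht h0
    rw [hg] at h0
    obtain ⟨w, hw, hw₁, hw₂⟩ := (hblack t ht).1
    obtain ⟨htr, hti⟩ := abs_sub_le_of_dist_le (hnear t ht s hs)
    have hr' : |(p t).re - (f.1 + 1 / 2)| < 1 / 2 := by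
      linarith [abs_sub_le (p t).re (p s).re (f.1 + 1 / 2)]
    have hi' : |(p t).im - (f.2 + 1 / 2)| < 1 / 2 := by
      linarith [abs_sub_le (p t).im (p s).im (f.2 + 1 / 2)]
    rcases eq_or_eq_of_abs_lt hd₁ hm₁ hw₁ hr' with h1 | h1 <;>
      rcases eq_or_eq_of_abs_lt hd₂ hm₂ hw₂ hi' with h2 | h2
    · -- the square of `v`: both signed coordinates `≤ 0`, sum `0`, so at the corner
      rw [h1] at hw₁; rw [h2] at hw₂
      obtain ⟨ha, ha'⟩ := mul_sub_nonpos hd₁ hm₁ hw₁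
      obtain ⟨hb, hb'⟩ := mul_sub_nonpos hd₂ hm₂ hw₂
      exact hoff t ht ⟨ha' (by linarith), hb' (by linarith)⟩
    · exact h34 ⟨w, hw, Or.inl ⟨h1, h2⟩⟩
    · exact h34 ⟨w, hw, Or.inr ⟨h1, h2⟩⟩
    · -- the square of `v'`
      rw [h1] at hw₁; rw [h2] at hw₂
      obtain ⟨ha, ha'⟩ := mul_sub_nonneg hd₁ hm₁ hw₁
      obtain ⟨hb, hb'⟩ := mul_sub_nonneg hd₂ hm₂ hw₂
      exact hoff t ht ⟨ha' (by linarith), hb' (by linarith)⟩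
  -- but `g s < 0 < g s'`
  have hgs : g s < 0 := by
    refine lt_of_le_of_ne ?_ (key s hs)
    rw [hg]; linarith [(mul_sub_nonpos hd₁ hm₁ hpv.1).1, (mul_sub_nonpos hd₂ hm₂ hpv.2).1]
  have hgs' : 0 < g s' := by
    refine lt_of_le_of_ne ?_ (key s' hs').symm
    rw [hg]; linarith [(mul_sub_nonneg hd₁ hm₁ hpv'.1).1, (mul_sub_nonneg hd₂ hm₂ hpv'.2).1]
  obtain ⟨t, ht, h0⟩ := intermediate_value_Icc hss' hgc ⟨hgs.le, hgs'.le⟩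
  exact key t ht h0

/-! ### One step of the chain -/

/-- **The diagonal step.**  Consecutive samples in the closed squares about diagonal neighbours
`v`, `v'` (both black): the chain passes through a third black square at the common corner (two
`ℤ²` edges) or through the corner's centre vertex when its hub coin is black (two centre edges);
all vertices used are within `3/4` of a point of the piece. [folklore] -/
theorem pathIn_of_diag (θ : LatConfig) {p : ℝ → ℂ} {s s' : ℝ} (hss' : s ≤ s')
    (hp : ContinuousOn p (Icc s s')) (hblack : ∀ t ∈ Icc s s', p t ∈ latBlack θ)
    (hnear : ∀ t ∈ Icc s s', ∀ t' ∈ Icc s s', dist (p t) (p t') ≤ 1 / 40) {v v' : ℤ × ℤ}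
    (memv : Sum.inl v ∈ {u | ∃ t ∈ Icc s s', dist (p t) (zGs u) ≤ 3 / 4} ∩ gsConfig θ)
    (hpv : |(p s).re - v.1| ≤ 1 / 2 ∧ |(p s).im - v.2| ≤ 1 / 2)
    (memv' : Sum.inl v' ∈ {u | ∃ t ∈ Icc s s', dist (p t) (zGs u) ≤ 3 / 4} ∩ gsConfig θ)
    (hpv' : |(p s').re - v'.1| ≤ 1 / 2 ∧ |(p s').im - v'.2| ≤ 1 / 2)
    (hd₁ : v'.1 - v.1 = 1 ∨ v'.1 - v.1 = -1) (hd₂ : v'.2 - v.2 = 1 ∨ v'.2 - v.2 = -1) :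
    PathIn Gs ({u | ∃ t ∈ Icc s s', dist (p t) (zGs u) ≤ 3 / 4} ∩ gsConfig θ)
      (Sum.inl v) (Sum.inl v') := by
  have hs : s ∈ Icc s s' := ⟨le_rfl, hss'⟩
  obtain ⟨hr, hi⟩ := abs_sub_le_of_dist_le (hnear s hs s' ⟨hss', le_rfl⟩)
  -- `p s` is within `21/40` of `v'` in each coordinate
  have h1 : |(p s).re - v'.1| ≤ 21 / 40 := (abs_sub_le _ (p s').re _).trans (by linarith [hpv'.1])
  have h2 : |(p s).im - v'.2| ≤ 21 / 40 := (abs_sub_le _ (p s').im _).trans (by linarith [hpv'.2])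
  -- the face `f` whose centre is the common corner of the two squares
  obtain ⟨f, hf₁, hf₂⟩ : ∃ f : ℤ × ℤ, 2 * f.1 + 1 = v.1 + v'.1 ∧ 2 * f.2 + 1 = v.2 + v'.2 :=
    ⟨((v.1 + v'.1 - 1) / 2, (v.2 + v'.2 - 1) / 2), by omega, by omega⟩
  have hm₁ : 2 * ((f.1 : ℝ) + 1 / 2) = v.1 + v'.1 := by
    linarith [(by exact_mod_cast hf₁ : (2 * f.1 + 1 : ℝ) = v.1 + v'.1)]
  have hm₂ : 2 * ((f.2 : ℝ) + 1 / 2) = v.2 + v'.2 := by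
    linarith [(by exact_mod_cast hf₂ : (2 * f.2 + 1 : ℝ) = v.2 + v'.2)]
  rcases exists_open_at_corner θ hss' hp hblack hnear hpv hpv' hd₁ hd₂ hm₁ hm₂ with
    ⟨w, hw, hw'⟩ | h5
  · -- through a third black square at the corner
    have memw : Sum.inl w ∈ {u | ∃ t ∈ Icc s s', dist (p t) (zGs u) ≤ 3 / 4} ∩ gsConfig θ := by
      refine ⟨⟨s, hs, dist_zGs_le ?_ ?_⟩, hw⟩
      · rw [zGs_re_inl]
        rcases hw' with ⟨e, -⟩ | ⟨e, -⟩ <;> rw [e] <;> linarith [hpv.1]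
      · rw [zGs_im_inl]
        rcases hw' with ⟨-, e⟩ | ⟨-, e⟩ <;> rw [e] <;> linarith [hpv.2]
    exact (PathIn.of_adj memv memw (inl_adj_inl_of (by omega))).tail (inl_adj_inl_of (by omega)) memv'
  · -- through the black-coined centre vertex of the corner
    have memf : Sum.inr f ∈ {u | ∃ t ∈ Icc s s', dist (p t) (zGs u) ≤ 3 / 4} ∩ gsConfig θ := by
      refine ⟨⟨s, hs, dist_zGs_le ?_ ?_⟩, h5⟩
      · rw [zGs_re_inr]; linarith [abs_sub_mid_le hd₁ hm₁ hpv.1 h1]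
      · rw [zGs_im_inr]; linarith [abs_sub_mid_le hd₂ hm₂ hpv.2 h2]
    refine (PathIn.of_adj memv memf ?_).tail ?_ memv'
    · rw [Gs_adj_inl_inr_iff]; omega
    · rw [Gs.adj_comm, Gs_adj_inl_inr_iff]; omega

/-- **One step of the chain.**  Consecutive samples `p s`, `p s'` of the piece at distance
`≤ 1/40` lie in closed black squares about `v`, `v'` with `|vᵢ - v'ᵢ| ≤ 1`: equal squares
(trivial path), an `ℤ²` edge, or the diagonal step. [folklore] -/
theorem pathIn_step (θ : LatConfig) {p : ℝ → ℂ} {s s' : ℝ} (hss' : s ≤ s')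
    (hp : ContinuousOn p (Icc s s')) (hblack : ∀ t ∈ Icc s s', p t ∈ latBlack θ)
    (hnear : ∀ t ∈ Icc s s', ∀ t' ∈ Icc s s', dist (p t) (p t') ≤ 1 / 40) {v v' : ℤ × ℤ}
    (hv : v ∈ θ.1) (hpv : |(p s).re - v.1| ≤ 1 / 2 ∧ |(p s).im - v.2| ≤ 1 / 2)
    (hv' : v' ∈ θ.1) (hpv' : |(p s').re - v'.1| ≤ 1 / 2 ∧ |(p s').im - v'.2| ≤ 1 / 2) :
    PathIn Gs ({u | ∃ t ∈ Icc s s', dist (p t) (zGs u) ≤ 3 / 4} ∩ gsConfig θ)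
      (Sum.inl v) (Sum.inl v') := by
  have hs : s ∈ Icc s s' := ⟨le_rfl, hss'⟩
  have hs' : s' ∈ Icc s s' := ⟨hss', le_rfl⟩
  obtain ⟨hr, hi⟩ := abs_sub_le_of_dist_le (hnear s hs s' hs')
  have memv : Sum.inl v ∈ {u | ∃ t ∈ Icc s s', dist (p t) (zGs u) ≤ 3 / 4} ∩ gsConfig θ :=
    ⟨⟨s, hs, dist_zGs_le (by rw [zGs_re_inl]; linarith [hpv.1])
      (by rw [zGs_im_inl]; linarith [hpv.2])⟩, hv⟩
  have memv' : Sum.inl v' ∈ {u | ∃ t ∈ Icc s s', dist (p t) (zGs u) ≤ 3 / 4} ∩ gsConfig θ :=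
    ⟨⟨s', hs', dist_zGs_le (by rw [zGs_re_inl]; linarith [hpv'.1])
      (by rw [zGs_im_inl]; linarith [hpv'.2])⟩, hv'⟩
  rcases int_sub_mem_of_abs_le hpv.1 hpv'.1 hr with h1 | h1 <;>
    rcases int_sub_mem_of_abs_le hpv.2 hpv'.2 hi with h2 | h2
  · rw [show v' = v from Prod.ext (by omega) (by omega)]
    exact PathIn.refl memv
  · exact PathIn.of_adj memv memv' (inl_adj_inl_of (by omega))
  · exact PathIn.of_adj memv memv' (inl_adj_inl_of (by omega))
  · exact pathIn_of_diag θ hss' hp hblack hnear memv hpv memv' hpv' h1 h2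

/-! ### The chain at mesh `1` and at mesh `δ` -/

/-- **The square-chain lemma at mesh `1`.**  A continuous piece `p|[a,b]` of `latBlack θ` is
shadowed by a `G_s`-path of `gsConfig θ`-open vertices within `3/4` of the piece, from a vertex
within `3/4` of `p a` to one within `3/4` of `p b`: sample at a modulus of uniform continuity for
`1/40` and concatenate the one-step paths. [folklore] -/
theorem exists_pathIn_of_continuousOn (θ : LatConfig) {p : ℝ → ℂ} {a b : ℝ} (hab : a ≤ b)
    (hp : ContinuousOn p (Icc a b)) (hblack : ∀ t ∈ Icc a b, p t ∈ latBlack θ) :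
    ∃ u w : (ℤ × ℤ) ⊕ (ℤ × ℤ), dist (p a) (zGs u) ≤ 3 / 4 ∧ dist (p b) (zGs w) ≤ 3 / 4 ∧
      PathIn Gs ({v | ∃ t ∈ Icc a b, dist (p t) (zGs v) ≤ 3 / 4} ∩ gsConfig θ) u w := by
  -- black squares containing the points of the piece
  have hsq : ∀ t, ∃ v : ℤ × ℤ, t ∈ Icc a b →
      v ∈ θ.1 ∧ |(p t).re - v.1| ≤ 1 / 2 ∧ |(p t).im - v.2| ≤ 1 / 2 := by
    intro t
    by_cases ht : t ∈ Icc a b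
    · obtain ⟨v, hv, h⟩ := (hblack t ht).1
      exact ⟨v, fun _ => ⟨hv, h⟩⟩
    · exact ⟨0, fun h => absurd h ht⟩
  choose V hV using hsq
  have hdV : ∀ t ∈ Icc a b, dist (p t) (zGs (Sum.inl (V t))) ≤ 3 / 4 := fun t ht =>
    dist_zGs_le (by rw [zGs_re_inl]; linarith [(hV t ht).2.1])
      (by rw [zGs_im_inl]; linarith [(hV t ht).2.2])
  -- uniform continuity of `p` on `[a, b]`: modulus `η` for `1/40`
  obtain ⟨η, hη, hηuc⟩ := Metric.uniformContinuousOn_iff_le.1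
    (isCompact_Icc.uniformContinuousOn_of_continuous hp) (1 / 40) (by norm_num)
  -- the subdivision of `[a, b]` into `N` steps of length `≤ η`
  obtain ⟨N, hN⟩ := exists_nat_gt ((b - a) / η)
  have hN0 : (0 : ℝ) < N := lt_of_le_of_lt (div_nonneg (sub_nonneg.2 hab) hη.le) hN
  have hq0 : 0 ≤ (b - a) / N := div_nonneg (sub_nonneg.2 hab) hN0.le
  have hqη : (b - a) / N ≤ η := by
    rw [div_le_iff₀ hN0]
    have := (div_lt_iff₀ hη).1 hN
    linarith [mul_comm (N : ℝ) η]
  obtain ⟨tt, htt⟩ : ∃ tt : ℕ → ℝ, ∀ i, tt i = a + i * ((b - a) / N) := ⟨_, fun _ => rfl⟩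
  have htt_mem : ∀ i : ℕ, i ≤ N → tt i ∈ Icc a b := by
    intro i hi
    have hi' : (i : ℝ) ≤ N := by exact_mod_cast hi
    have h1 : (i : ℝ) * ((b - a) / N) ≤ N * ((b - a) / N) := mul_le_mul_of_nonneg_right hi' hq0
    rw [mul_div_cancel₀ _ hN0.ne'] at h1
    rw [htt]
    exact ⟨le_add_of_nonneg_right (mul_nonneg i.cast_nonneg hq0), by linarith⟩
  have htt_sub : ∀ i : ℕ, tt (i + 1) - tt i = (b - a) / N := by
    intro i; rw [htt, htt, Nat.cast_succ]; ring
  have htt_le : ∀ i : ℕ, tt i ≤ tt (i + 1) := fun i => by linarith [htt_sub i]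
  -- the chain along the subdivision, by induction
  have hchain : ∀ n : ℕ, n ≤ N → PathIn Gs
      ({v | ∃ t ∈ Icc a b, dist (p t) (zGs v) ≤ 3 / 4} ∩ gsConfig θ)
      (Sum.inl (V (tt 0))) (Sum.inl (V (tt n))) := by
    intro n
    induction n with
    | zero => exact fun h => PathIn.refl ⟨⟨tt 0, htt_mem 0 h, hdV _ (htt_mem 0 h)⟩, (hV _ (htt_mem 0 h)).1⟩
    | succ n ih =>
      intro hn
      have hn' : n ≤ N := Nat.le_of_succ_le hn
      have hI : Icc (tt n) (tt (n + 1)) ⊆ Icc a b :=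
        Icc_subset_Icc (htt_mem n hn').1 (htt_mem _ hn).2
      refine (ih hn').trans (PathIn.mono ?_ (pathIn_step θ (htt_le n) (hp.mono hI)
        (fun t ht => hblack t (hI ht)) ?_ (hV _ (htt_mem n hn')).1 (hV _ (htt_mem n hn')).2
        (hV _ (htt_mem _ hn)).1 (hV _ (htt_mem _ hn)).2))
      · rintro u ⟨⟨t, ht, hd⟩, hu⟩
        exact ⟨⟨t, hI ht, hd⟩, hu⟩
      · intro t ht t' ht'
        refine hηuc t (hI ht) t' (hI ht') ((Real.dist_le_of_mem_Icc ht ht').trans ?_)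
        rw [htt_sub]
        exact hqη
  -- endpoints: `tt 0 = a`, `tt N = b`
  have htt0 : tt 0 = a := by rw [htt, Nat.cast_zero, zero_mul, add_zero]
  have httN : tt N = b := by rw [htt, mul_div_cancel₀ _ hN0.ne']; ring
  have hc := hchain N le_rfl
  rw [htt0, httN] at hc
  exact ⟨_, _, hdV a ⟨le_rfl, hab⟩, hdV b ⟨hab, le_rfl⟩, hc⟩

/-- **Registered stub `stub_latticeChain` (the square-chain lemma).**  At mesh `δ`, a sub-path
`γ|[a,b]` inside the scaled lattice-end black region `δ · latBlack θ` is shadowed by a `Gs`-path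
of `gsConfig θ`-open vertices all within `3δ/4` of it, from a vertex within `3δ/4` of `γ(a)` to
one within `3δ/4` of `γ(b)` (the mesh-`1` lemma applied to `t ↦ γ.extend t / δ`). [folklore] -/
theorem stub_latticeChain : ∀ {δ : ℝ}, 0 < δ → ∀ (θ : LatConfig) {x y : ℂ} (γ : Path x y) (a b : ℝ),
    0 ≤ a → a ≤ b → b ≤ 1 → (∀ t ∈ Icc a b, γ.extend t / (δ : ℂ) ∈ latBlack θ) →
    ∃ u w : (ℤ × ℤ) ⊕ (ℤ × ℤ), dist (γ.extend a) ((δ : ℂ) * zGs u) ≤ 3 / 4 * δ ∧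
      dist (γ.extend b) ((δ : ℂ) * zGs w) ≤ 3 / 4 * δ ∧
      Literature.Probability.Percolation.PathIn Gs
        ({v | ∃ t ∈ Icc a b, dist (γ.extend t) ((δ : ℂ) * zGs v) ≤ 3 / 4 * δ} ∩ gsConfig θ) u w := by
  intro δ hδ θ x y γ a b _ hab _ hblack
  have hp : ContinuousOn (fun t => γ.extend t / (δ : ℂ)) (Icc a b) :=
    (γ.continuous_extend.div_const _).continuousOn
  have key : ∀ (t : ℝ) (v : (ℤ × ℤ) ⊕ (ℤ × ℤ)),
      dist (γ.extend t) ((δ : ℂ) * zGs v) = δ * dist (γ.extend t / δ) (zGs v) := by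
    intro t v
    have e : (δ : ℂ) * (γ.extend t / δ) = γ.extend t :=
      mul_div_cancel₀ _ (Complex.ofReal_ne_zero.mpr hδ.ne')
    calc dist (γ.extend t) ((δ : ℂ) * zGs v)
        = dist ((δ : ℂ) * (γ.extend t / δ)) ((δ : ℂ) * zGs v) := by rw [e]
      _ = δ * dist (γ.extend t / δ) (zGs v) := by rw [dist_mul_zGs, abs_of_pos hδ]
  obtain ⟨u, w, hu, hw, hP⟩ := exists_pathIn_of_continuousOn θ hab hp hblack
  refine ⟨u, w, ?_, ?_, ?_⟩
  · rw [key]; nlinarith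
  · rw [key]; nlinarith
  · have e : {v | ∃ t ∈ Icc a b, dist (γ.extend t) ((δ : ℂ) * zGs v) ≤ 3 / 4 * δ} =
        {v | ∃ t ∈ Icc a b, dist (γ.extend t / δ) (zGs v) ≤ 3 / 4} := by
      ext v
      simp only [mem_setOf_eq, key]
      constructor <;> rintro ⟨t, ht, h⟩ <;> exact ⟨t, ht, by nlinarith⟩
    rw [e]
    exact hP

end Summit.CriticalPhenomena.CardyFormulaZ2.Cruxes.SquareFromVoronoiHub.PoissonDilutionLeg

end
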